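import Summits.SmoothPoincare4.SmoothPoincare4.Theorems.ConvexBisectionAcyclicBisectionExistsStabilisationWord
import Summits.SmoothPoincare4.SmoothPoincare4.Theorems.ConvexBisectionAcyclicBisectionExistsDualHandleCompatibleSplit
import Summits.SmoothPoincare4.SmoothPoincare4.Theorems.ConvexBisectionAcyclicBisectionExistsModelsTransport
import HarnessLib

/-!
# N3 (`stub_STgeo`) ▸ N3-nat ▸ piece N3d-4/5/6 ▸ sub-piece (T3) `piece4_finish`: THE FINISH — from the
# dualised fibred datum (block handles at positions `0,1,2,3`, old handles at `k+4`) to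
# `ModelsOnFibred M (g+1) (natWord g c l)`, PROVED
(wave 8, brick J7-7 of stub `stub_STgeo` = node N3 of NF4, line `modp-braid-orbits`, crux
`ConvexBisection.AcyclicBisectionExists`, item stmt-SmoothPoincare4-10508; registered sub-goal `piece4_finish`
(text `work/stubs/sig_piece4_finish.txt` = hypothesis `hT3` of the landed contract
`StabTradeContract.node_trade_of_subpieces`, `…StabTradeContract.lean`); design file
`work/design/N3d_Pieces_Design.lean` (J7, wave 8) §D.)

The dualised datum is indexed by `Fin 4 ⊕ Fin n` (block order `A, A*, B, B*` with shadows `a, a, b, b` and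
page twistings `−1, 1, −1, 1` in the pages `pageDir (n+4) i`, old handles at `pageDir (n+4) (k+4)` with
shadows `embed` and the old twistings).  Re-index along
`Fin (natWord g c l).length ≃ Fin 4 ⊕ Fin n` (`finCongr` + `finSumFinEquiv`; `length_natWord`) with
V5's `MultiAttachmentData.reindexData` (same base embedding on points, so the seam clause is kept
literally), read `IsLefschetzLink (g+1) (natWord g c l)` off the clauses (letters of `natWord`:
`(a,+),(a,−),(b,+),(b,−)` then `(embed l_k, s_k)`, `get_natWord_add_four`), and conclude by
`modelsOnFibred_of_data`.  Everything is proved; no definitions.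
References: J. B. Etnyre, T. Fuller, IMRN 2006, Thm. 1 (proof, p. 8) [EtnyreFuller2006]; R. İ. Baykur, AGT 6
(2006), §5 p. 13 [Baykur2006].
-/

noncomputable section

-- the prescribed namespace `Summit.<P>.<Sub>.…` duplicates `SmoothPoincare4` (P = Sub)
set_option linter.dupNamespace false

open scoped Manifold ContDiff Topology Real
open Set Function

namespace Summit.SmoothPoincare4.SmoothPoincare4.Theorems.AcyclicBisectionExists.ModpBraidOrbits

open Literature.GroupTheory.CombinatorialGroupTheory.SignedHurwitz
open Literature.Topology.FourManifolds Literature.Topology.FourManifolds.LefschetzBase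
open Literature.Topology.FourManifolds.HandleAttachingMap
open Literature.Geometry.Symplectic

namespace StabTradeFinish

variable {g : ℕ}

/-- The block letters of the natural word, `ℕ`-indexed. [folklore] -/
theorem get_natWord_of_lt_four (c : Fin g ⊕ Fin g → ℤ) (l : IntWord g) (jv : ℕ) (hj : jv < 4)
    (h : jv < (natWord g c l).length) :
    (natWord g c l).get ⟨jv, h⟩ =
      (![newE g + embed g c, newE g + embed g c, newF g, newF g] ⟨jv, hj⟩,
        ![true, false, true, false] ⟨jv, hj⟩) := by
  interval_cases jv <;> rfl

/-- The signs of the block letters as page twistings. [folklore] -/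
theorem twist_of_lt_four (jv : ℕ) (hj : jv < 4) :
    ![(-1 : ℤ), 1, -1, 1] ⟨jv, hj⟩ = if ![true, false, true, false] ⟨jv, hj⟩ then -1 else 1 := by
  interval_cases jv <;> rfl

/-- Along the re-indexing `Fin (natWord g c l).length ≃ Fin 4 ⊕ Fin n` (block positions first), a position
`< 4` is a block position. [folklore] -/
theorem blockIdx_of_lt (c : Fin g ⊕ Fin g → ℤ) (l : IntWord g) (hl : (natWord g c l).length = 4 + l.length)
    (j : Fin (natWord g c l).length) (hj : (j : ℕ) < 4) :
    ((finCongr hl).trans finSumFinEquiv.symm) j = Sum.inl ⟨j, hj⟩ := by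
  have h1 : finCongr hl j = Fin.castAdd l.length (⟨j, hj⟩ : Fin 4) := Fin.ext rfl
  show finSumFinEquiv.symm (finCongr hl j) = _
  rw [h1, finSumFinEquiv_symm_apply_castAdd]

/-- … and a position `≥ 4` is an old position. [folklore] -/
theorem blockIdx_of_le (c : Fin g ⊕ Fin g → ℤ) (l : IntWord g) (hl : (natWord g c l).length = 4 + l.length)
    (j : Fin (natWord g c l).length) (hj : 4 ≤ (j : ℕ)) :
    ((finCongr hl).trans finSumFinEquiv.symm) j =
      Sum.inr ⟨(j : ℕ) - 4, by have := j.2.trans_eq (length_natWord g c l); omega⟩ := by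
  have h1 : finCongr hl j =
      Fin.natAdd 4 (⟨(j : ℕ) - 4, by have := j.2.trans_eq (length_natWord g c l); omega⟩ : Fin l.length) :=
    Fin.ext (by simp only [finCongr_apply, Fin.val_cast, Fin.natAdd_mk]; omega)
  show finSumFinEquiv.symm (finCongr hl j) = _
  rw [h1, finSumFinEquiv_symm_apply_natAdd]

end StabTradeFinish

open StabTradeFinish in
/-- **Sub-piece (T3) `piece4_finish` of N3d-4/5/6 — THE FINISH, PROVED** (text
`work/stubs/sig_piece4_finish.txt` VERBATIM = hypothesis `hT3` of `StabTradeContract.node_trade_of_subpieces`):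
a dualised fibred datum of `M` over `Base (g+1)` with the block handles at the positions `0, 1, 2, 3` gives
`ModelsOnFibred M (g+1) (natWord g c l)`. [cite: EtnyreFuller2006, Thm. 1 (proof, p. 8)] -/
theorem piece4_finish : ∀ (M : Type) [TopologicalSpace M] [T2Space M] [SecondCountableTopology M] [ChartedSpace (EuclideanSpace ℝ (Fin 4)) M] [IsManifold (𝓡 4) ∞ M] (g : ℕ) (l : Literature.GroupTheory.CombinatorialGroupTheory.SignedHurwitz.IntWord g) (c : Fin g ⊕ Fin g → ℤ) (S : Summit.SmoothPoincare4.SmoothPoincare4.Theorems.AcyclicBisectionExists.ModpBraidOrbits.StabBaseData g l.length c), (∃ (X'' : Type) (_ : TopologicalSpace X'') (_ : T2Space X'') (_ : SecondCountableTopology X'') (_ : CompactSpace X'') (_ : ChartedSpace (EuclideanHalfSpace 4) X'') (_ : IsManifold (𝓡∂ 4) ∞ X'') (h'' : Fin 4 ⊕ Fin l.length → Literature.Topology.FourManifolds.HandleAttachingMap 3 2 (Literature.Topology.FourManifolds.LefschetzBase.Base (g + 1))) (D'' : Literature.Topology.FourManifolds.HandleAttachingMap.MultiAttachmentData h'' (𝓡∂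 4) X'') (bX'' : Literature.Topology.FourManifolds.BoundaryData (𝓡∂ 4) X'' (𝓡 3)) (Ψ'' : bX''.carrier ≃ₘ⟮𝓡 3, 𝓡 3⟯ (Literature.Topology.FourManifolds.LefschetzBase.bBase (g + 1)).carrier), (∀ (i : Fin 4) θ, (h'' (Sum.inl i)).attachingCircle θ ∈ Literature.Topology.FourManifolds.LefschetzBase.page (g + 1) (Literature.Topology.FourManifolds.LefschetzBase.pageDir (l.length + 4) i)) ∧ (∀ (k : Fin l.length) θ, (h'' (Sum.inr k)).attachingCircle θ ∈ Literature.Topology.FourManifolds.LefschetzBase.page (g + 1) (Literature.Topology.FourManifolds.LefschetzBase.pageDir (l.length + 4) (k + 4))) ∧ (∀ i, Literature.Topology.FourManifolds.LefschetzBase.shadow (g + 1) (h'' (Sum.inl i)).attachingCircle (h'' (Sum.inl i)).continuous_attachingCircle = ![Literature.GroupTheory.CombinatorialGroupTheory.SignedHurwitz.newE g + Literature.GroupTheory.CombinatorialGroupTheory.SignedHurwitz.embed g c, Literature.GroupTheory.CombinatorialGroupTheory.SignedHurwitz.newE g + Literature.GroupTheory.CombinatorialGroupTheory.SignedHurwitz.embed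 g c, Literature.GroupTheory.CombinatorialGroupTheory.SignedHurwitz.newF g, Literature.GroupTheory.CombinatorialGroupTheory.SignedHurwitz.newF g] i) ∧ (∀ k, Literature.Topology.FourManifolds.LefschetzBase.shadow (g + 1) (h'' (Sum.inr k)).attachingCircle (h'' (Sum.inr k)).continuous_attachingCircle = Literature.GroupTheory.CombinatorialGroupTheory.SignedHurwitz.embed g (l.get k).1) ∧ (∀ i, Literature.Topology.FourManifolds.LefschetzBase.pageTwisting (g + 1) (h'' (Sum.inl i)).attachingCircle (h'' (Sum.inl i)).attachingFraming = ![(-1 : ℤ), 1, -1, 1] i) ∧ (∀ k, Literature.Topology.FourManifolds.LefschetzBase.pageTwisting (g + 1) (h'' (Sum.inr k)).attachingCircle (h'' (Sum.inr k)).attachingFraming = if (l.get k).2 then -1 else 1) ∧ Literature.Topology.FourManifolds.IsBoundaryGluing bX'' (Literature.Topology.FourManifolds.LefschetzBase.bBase (g + 1)) Ψ'' (𝓡 4) M ∧ (∀ (y : bX''.carrier) (a : ↥(Literature.Topology.FourManifolds.HandleAttachingMap.coresComplement h'')), bX''.incl y = D''.jA a → ∃ r : ℝ, 0 < r ∧ Literature.Topology.FourManifolds.LefschetzBase.w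 (g + 1) ((Literature.Topology.FourManifolds.LefschetzBase.bBase (g + 1)).incl (Ψ'' y)).1 = (r : ℂ) * Literature.Topology.FourManifolds.LefschetzBase.w (g + 1) (a : Literature.Topology.FourManifolds.LefschetzBase.Base (g + 1)).1)) → Literature.Topology.FourManifolds.LefschetzBase.ModelsOnFibred M (g + 1) (Summit.SmoothPoincare4.SmoothPoincare4.Theorems.AcyclicBisectionExists.ModpBraidOrbits.natWord g c l) := by
  intro M _ _ _ _ _ g l c S hdual
  obtain ⟨X'', _, _, _, _, _, _, h'', D'', bX'', Ψ'', hp4, hpk, hs4, hsk, ht4, htk, hglue, hseam⟩ := hdual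
  have hN : (natWord g c l).length = l.length + 4 := length_natWord g c l
  -- the re-indexed family and data
  have hl : (natWord g c l).length = 4 + l.length := by rw [length_natWord, add_comm]
  let e : Fin (natWord g c l).length ≃ Fin 4 ⊕ Fin l.length := (finCongr hl).trans finSumFinEquiv.symm
  let h' : Fin (natWord g c l).length → HandleAttachingMap 3 2 (Base (g + 1)) := fun j => h'' (e j)
  have he : ∀ j, h' j = h'' (e j) := fun _ => rfl
  let D' : MultiAttachmentData h' (𝓡∂ 4) X'' := D''.reindexData e he
  -- the old bound
  have hold_lt : ∀ j : Fin (natWord g c l).length, 4 ≤ (j : ℕ) → (j : ℕ) - 4 < l.length := fun j hj => by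
    have := j.2.trans_eq hN; omega
  have hlink : IsLefschetzLink (g + 1) (natWord g c l) h' := by
    refine ⟨D'.disjoint, fun j θ => ?_, fun j => ?_, fun j => ?_⟩
    · -- pages
      rw [show pageDir (natWord g c l).length (j : ℕ) = pageDir (l.length + 4) (j : ℕ) from
        congrArg (fun m => pageDir m (j : ℕ)) hN]
      by_cases hj : (j : ℕ) < 4
      · have hj' : h' j = h'' (Sum.inl ⟨j, hj⟩) := by rw [he, show e j = _ from blockIdx_of_lt c l hl j hj]
        rw [hj']
        exact hp4 ⟨j, hj⟩ θ
      · have hj4 : 4 ≤ (j : ℕ) := not_lt.1 hj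
        have hj' : h' j = h'' (Sum.inr ⟨(j : ℕ) - 4, hold_lt j hj4⟩) := by
          rw [he, show e j = _ from blockIdx_of_le c l hl j hj4]
        rw [hj']
        have h44 : (j : ℕ) - 4 + 4 = (j : ℕ) := by omega
        have := hpk ⟨(j : ℕ) - 4, hold_lt j hj4⟩ θ
        rwa [show (((⟨(j : ℕ) - 4, hold_lt j hj4⟩ : Fin l.length) : ℕ) + 4) = (j : ℕ) from h44] at this
    · -- shadows
      obtain ⟨jv, hjv⟩ := j
      by_cases hj : jv < 4
      · have hj' : h' ⟨jv, hjv⟩ = h'' (Sum.inl ⟨jv, hj⟩) := by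
          rw [he, show e ⟨jv, hjv⟩ = _ from blockIdx_of_lt c l hl ⟨jv, hjv⟩ hj]
        rw [hj', hs4 ⟨jv, hj⟩, get_natWord_of_lt_four c l jv hj hjv]
      · have hj4 : 4 ≤ jv := not_lt.1 hj
        have hj' : h' ⟨jv, hjv⟩ = h'' (Sum.inr ⟨jv - 4, hold_lt ⟨jv, hjv⟩ hj4⟩) := by
          rw [he, show e ⟨jv, hjv⟩ = _ from blockIdx_of_le c l hl ⟨jv, hjv⟩ hj4]
        rw [hj', hsk ⟨jv - 4, hold_lt ⟨jv, hjv⟩ hj4⟩]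
        have h44 : jv - 4 + 4 = jv := by omega
        have hget := StabilisationData.get_natWord_add_four c l ⟨jv - 4, hold_lt ⟨jv, hjv⟩ hj4⟩
          (by simpa [h44] using hjv)
        simp only [h44] at hget
        rw [hget]
    · -- twistings
      obtain ⟨jv, hjv⟩ := j
      by_cases hj : jv < 4
      · have hj' : h' ⟨jv, hjv⟩ = h'' (Sum.inl ⟨jv, hj⟩) := by
          rw [he, show e ⟨jv, hjv⟩ = _ from blockIdx_of_lt c l hl ⟨jv, hjv⟩ hj]
        rw [hj', ht4 ⟨jv, hj⟩, get_natWord_of_lt_four c l jv hj hjv, twist_of_lt_four jv hj]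
      · have hj4 : 4 ≤ jv := not_lt.1 hj
        have hj' : h' ⟨jv, hjv⟩ = h'' (Sum.inr ⟨jv - 4, hold_lt ⟨jv, hjv⟩ hj4⟩) := by
          rw [he, show e ⟨jv, hjv⟩ = _ from blockIdx_of_le c l hl ⟨jv, hjv⟩ hj4]
        rw [hj', htk ⟨jv - 4, hold_lt ⟨jv, hjv⟩ hj4⟩]
        have h44 : jv - 4 + 4 = jv := by omega
        have hget := StabilisationData.get_natWord_add_four c l ⟨jv - 4, hold_lt ⟨jv, hjv⟩ hj4⟩
          (by simpa [h44] using hjv)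
        simp only [h44] at hget
        rw [hget]
  exact modelsOnFibred_of_data hlink D' bX'' Ψ'' hglue fun y a hy => hseam y (reindexCongr e he a) hy

end Summit.SmoothPoincare4.SmoothPoincare4.Theorems.AcyclicBisectionExists.ModpBraidOrbits

end
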